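import Summits.ABC.ABC.Theorems.CubicResolventAllowanceResolventPayoff
import HarnessLib

/-!
# Stub-ideation k=2 (RESHAPE), GEN 8 — `stub_realCubic` of crux `IndexSzpiro` (stmt-ABC-22740)

Companion of `STUB-IDEAS-stub_realCubic-2.md` (gen 8).  Gens 2–7 of this slot stand by reference and are NOT
repeated (dictionary / CORE A, frame normalisation, exceptional set, Roth–Ridout ladder, U1, H1–H5, gen 7: R1
`IndexSzpiro ↔ StubReal ∧ StubComplex`, J1–J3, S2–S3).  Gen 8 types three RESHAPE moves missing on the page:

* §I  **Extension of scalars to the resolvent field `K` itself.**  Over `K` the curve LEAVES the class (I2/I3: `ψ₂`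
  acquires the root `θ`, PROVED), and `0 < d_K` is exactly "`K` totally real" (I4, Brill), i.e. exactly the
  existence condition of Shimura-curve parametrisations of `E_K` (odd degree `3`): the sign hypothesis of the stub
  is the entrance ticket to Pasten's modular approach over totally real fields (arXiv:1705.09251 Thm 1.17,
  Conj 18.11, Thm 18.13), which has NO analogue for the complex twin.  Typed: the conjectural input over `K`
  (I5 `PastenShapeCubic κ`), the base-change bookkeeping (I6), and the composition to a class statement in the
  stub's two-parameter currency with `(Λ, A) = (κ, κ/3)` (I7, PROVED incl. the cube-root algebra `cubeRoot_le`).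
* §II **Currency surgery against the deciding theorem.**  The landed `resolventPayoff_proof` consumes the crux at
  `ε = 1` only, to produce slope `9`; the weakest `r = 0` statement that feeds `closes` verbatim is class
  polynomial Szpiro (II1).  PROVED: `stub → ClassPolySzpiroReal` (II2), the re-glued payoff
  `ClassPolySzpiroCubic → X2 → X3 → ResolventDiscBounds → A-PS` (II3) and the re-glued chain to the summit through
  the route's residual (II4) — the `6 + ε` and the `|d_K|¹` of the stub are not load-bearing for the route.
* §III **The two-parameter allowance ladder** `S(Λ, A) : Δ_min ≤ C |d_K|^A N^Λ` on the real class: the stub is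
  `∀ ε > 0, S(6+ε, 1)` (III2, PROVED), `S` is monotone (III3, PROVED); §I lands at `S(κ, κ/3)` (semistable,
  conditional), §II needs only `∃ Λ A, S(Λ, A)`.

No `sorry`: I1–I3, I7 (+ `cubeRoot_le`), II2–II4, III2–III4 are proved; I4, I5, I6, II1, III1 are named `Prop`s.
-/

noncomputable section

open Polynomial NumberField WeierstrassCurve
open Summit.ABC.ABC.Theses.CubicResolventAllowance Summit.ABC.ABC.Theorems

namespace Summit.ABC.ABC.Cruxes.IndexSzpiro.StubIdeas2RealG8

/-! ## §0 The registered stub, verbatim (skeleton `line2-birth.lean`, sha d34fb8f2…) -/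

/-- `stub_realCubic`, verbatim. -/
def StubRealCubic : Prop :=
  ∀ ε : ℝ, 0 < ε → ∃ C : ℝ, ∀ (W : WeierstrassCurve ℚ) [W.IsElliptic] (K : Type) [Field K] [NumberField K],
    Irreducible W.twoTorsionPolynomial.toPoly → Module.finrank ℚ K = 3 →
    (∃ θ : K, aeval θ W.twoTorsionPolynomial.toPoly = 0) → 0 < NumberField.discr K →
    (W.minimalDiscriminantNorm ℤ : ℝ) ≤ C * |(NumberField.discr K : ℝ)| * (W.conductorNorm ℤ : ℝ) ^ (6 + ε)

/-! ## §I  Extension of scalars to the resolvent field -/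

/-- **I1 (S, PROVED).** The 2-division cubic commutes with ring maps (tree:
`WeierstrassCurve.map_twoTorsionPolynomial_toPoly`, re-proved here to keep the import light). [folklore] -/
theorem twoTorsionPolynomial_toPoly_map {R S : Type*} [CommRing R] [CommRing S] (W : WeierstrassCurve R)
    (φ : R →+* S) : (W.map φ).twoTorsionPolynomial.toPoly = W.twoTorsionPolynomial.toPoly.map φ := by
  rw [← Cubic.map_toPoly]
  congr 1
  simp only [twoTorsionPolynomial, Cubic.map, map_b₂, map_b₄, map_b₆, map_ofNat, map_mul]

/-- **I2 (S, PROVED).** Over the resolvent field the 2-division cubic of `E_K = W ×_ℚ K` HAS the root `θ`: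
`E_K` has a `K`-rational 2-torsion abscissa. [folklore] -/
theorem isRoot_twoTorsionPolynomial_map (W : WeierstrassCurve ℚ) (K : Type) [Field K] [NumberField K]
    {θ : K} (hθ : aeval θ W.twoTorsionPolynomial.toPoly = 0) :
    (W.map (algebraMap ℚ K)).twoTorsionPolynomial.toPoly.IsRoot θ := by
  rw [IsRoot.def, twoTorsionPolynomial_toPoly_map, eval_map, ← aeval_def, hθ]

/-- **I3 (S, PROVED).** Hence over `K` the curve LEAVES the stub's class: `ψ₂(E_K)` is reducible over `K`
(`E_K` sits in the route's `r ≥ 1` classes over `K`, where the 2-isogeny / index mechanism of X2–X3 lives). [folklore] -/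
theorem not_irreducible_twoTorsionPolynomial_map (W : WeierstrassCurve ℚ) (K : Type) [Field K] [NumberField K]
    {θ : K} (hθ : aeval θ W.twoTorsionPolynomial.toPoly = 0) :
    ¬ Irreducible (W.map (algebraMap ℚ K)).twoTorsionPolynomial.toPoly := by
  intro hirr
  have h1 : (W.map (algebraMap ℚ K)).twoTorsionPolynomial.toPoly.natDegree = 1 :=
    Polynomial.natDegree_eq_of_degree_eq_some
      (Polynomial.degree_eq_one_of_irreducible_of_root hirr (isRoot_twoTorsionPolynomial_map W K hθ))
  have h3 : (W.map (algebraMap ℚ K)).twoTorsionPolynomial.toPoly.natDegree = 3 :=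
    Cubic.natDegree_of_a_ne_zero (by norm_num [WeierstrassCurve.twoTorsionPolynomial])
  omega

/-- **I4 (M, named hypothesis — Brill / Stickelberger sign).** For a cubic field, `0 < d_K ⟺ K` totally real
(`sign d_K = (−1)^{r₂}`, `r₂ ∈ {0, 1}`).  Not in Mathlib; on the stub's class it also follows from the keystone
`Δ(W) = q²·d_K` (k1 G5) and `RealCubicRoots.discr_pos_iff_card_roots_eq_three`. [cite: NeukirchANT1999, III.2.11 Ex. 3 / I.2 (Stickelberger, Brill)] -/
def SignDoorTotallyReal : Prop :=
  ∀ (K : Type) [Field K] [NumberField K], Module.finrank ℚ K = 3 →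
    (0 < NumberField.discr K ↔ NumberField.IsTotallyReal K)

/-- **I5 (CONJECTURAL INPUT, typed over `K`; never a Literature fact).** Pasten's Conjecture 18.11 (`log δ_E <
κ·log(d_F·N𝔑)`) in the form of its consequence Thm 18.13 for totally real CUBIC fields: for semistable `E/K`,
`N_{K/ℚ}(𝔇_{E/K}) ≤ C·(d_K · N_{K/ℚ}𝔣_{E/K})^κ`, `κ = κ(3)`.  Thm 18.13 needs modularity of `E/K` — for a base
change `E_K = W ×_ℚ K` this is cubic base change (Jacquet–PS–Shalika) of the modularity of `W/ℚ`; for all `E/K`,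
`K` totally real cubic, it is Derickx–Najman–Siksek 2020.  The Shimura curve exists because `[K:ℚ] = 3` is odd.
[cite: arXiv:1705.09251, Conj. 18.11 and Thm. 18.13 (p. 58); Thm. 1.17 (p. 9)] -/
def PastenShapeCubic (κ : ℝ) : Prop :=
  ∃ C : ℝ, ∀ (K : Type) [Field K] [NumberField K] [NumberField.IsTotallyReal K], Module.finrank ℚ K = 3 →
    ∀ (E : WeierstrassCurve K) [E.IsElliptic], E.IsSemistable (𝓞 K) →
      (E.minimalDiscriminantNorm (𝓞 K) : ℝ) ≤
        C * (|(NumberField.discr K : ℝ)| * (E.conductorNorm (𝓞 K) : ℝ)) ^ κ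

/-- **I6 (M, target — base-change bookkeeping for SEMISTABLE `W/ℚ`).** Semistability, hence minimality of a
minimal model, survives any base change (`v(c₄) = 0` criterion at multiplicative primes, `v(Δ) = 0` at good ones),
so `ord_𝔭 𝔇(E_K) = e_𝔭 · ord_p Δ_min(W)` and `N_{K/ℚ} 𝔇(E_K) = |Δ_min(W)|^{[K:ℚ]}`; and `f_𝔭(E_K) = 1` at bad `𝔭`,
so `N_{K/ℚ} 𝔣(E_K) = ∏_{p ∣ N} ∏_{𝔭 ∣ p} N𝔭 ≤ N³`.  Additive `W` is excluded on purpose (potentially good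
reduction can LOWER `𝔇` over `K`). [cite: SilvermanAEC2009, VII.5.4 and VII.1.3; Silverman1994, IV.10.2 (semistable ⟺ `f_v ≤ 1`)] -/
def BaseChangeBookkeeping : Prop :=
  ∀ (W : WeierstrassCurve ℚ) [W.IsElliptic] (K : Type) [Field K] [NumberField K], Module.finrank ℚ K = 3 →
    W.IsSemistable ℤ →
      (W.map (algebraMap ℚ K)).IsSemistable (𝓞 K) ∧
      (W.map (algebraMap ℚ K)).minimalDiscriminantNorm (𝓞 K) = W.minimalDiscriminantNorm ℤ ^ 3 ∧
      (W.map (algebraMap ℚ K)).conductorNorm (𝓞 K) ≤ W.conductorNorm ℤ ^ 3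

/-- The stub's inequality in TWO-PARAMETER currency on the SEMISTABLE part of the real class:
`Δ_min ≤ C · |d_K|^A · N^Λ`. -/
def SemistableRealClassAllowance (Λ A : ℝ) : Prop :=
  ∃ C : ℝ, ∀ (W : WeierstrassCurve ℚ) [W.IsElliptic] (K : Type) [Field K] [NumberField K],
    Irreducible W.twoTorsionPolynomial.toPoly → Module.finrank ℚ K = 3 →
    (∃ θ : K, aeval θ W.twoTorsionPolynomial.toPoly = 0) → 0 < NumberField.discr K → W.IsSemistable ℤ →
    (W.minimalDiscriminantNorm ℤ : ℝ) ≤ C * |(NumberField.discr K : ℝ)| ^ A * (W.conductorNorm ℤ : ℝ) ^ Λ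

/-- Cube-root algebra: `Δ³ ≤ C (d N³)^κ ⟹ Δ ≤ C^{1/3} d^{κ/3} N^κ` (all quantities `≥ 0`). [folklore] -/
theorem cubeRoot_le {Δ d N C κ : ℝ} (hΔ : 0 ≤ Δ) (hd : 0 ≤ d) (hN : 0 ≤ N) (hC : 0 ≤ C)
    (h : Δ ^ 3 ≤ C * (d * N ^ 3) ^ κ) : Δ ≤ C ^ ((1 : ℝ) / 3) * d ^ (κ / 3) * N ^ κ := by
  have hR0 : 0 ≤ C ^ ((1 : ℝ) / 3) * d ^ (κ / 3) * N ^ κ := by positivity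
  have h1 : (C ^ ((1 : ℝ) / 3)) ^ (3 : ℕ) = C := by
    rw [← Real.rpow_natCast, ← Real.rpow_mul hC]; norm_num
  have h2 : (d ^ (κ / 3)) ^ (3 : ℕ) = d ^ κ := by
    rw [← Real.rpow_natCast, ← Real.rpow_mul hd]
    congr 1; push_cast; ring
  have h3 : (N ^ κ) ^ (3 : ℕ) = (N ^ (3 : ℕ)) ^ κ := by
    rw [← Real.rpow_natCast, ← Real.rpow_mul hN, ← Real.rpow_natCast N 3, ← Real.rpow_mul hN]
    congr 1; push_cast; ring
  have hR3 : (C ^ ((1 : ℝ) / 3) * d ^ (κ / 3) * N ^ κ) ^ (3 : ℕ) = C * (d * N ^ 3) ^ κ := by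
    rw [mul_pow, mul_pow, h1, h2, h3, Real.mul_rpow hd (pow_nonneg hN 3)]; ring
  have h' : Δ ^ (3 : ℕ) ≤ (C ^ ((1 : ℝ) / 3) * d ^ (κ / 3) * N ^ κ) ^ (3 : ℕ) := hR3 ▸ h
  exact (pow_le_pow_iff_left₀ hΔ hR0 (by norm_num)).mp h'

/-- **I7 (S, PROVED — the composition).** Pasten's conjectural bound over totally real cubic fields + the sign door +
semistable base-change bookkeeping give the stub's inequality on the SEMISTABLE real class in currency
`(Λ, A) = (κ, κ/3)`: `Δ_min(W) ≤ C' · d_K^{κ/3} · N^κ`.  This is the ONE mechanism on the page that uses `0 < d_K`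
essentially (no Shimura curve over the complex twin's mixed-signature field); it does NOT reach `(6 + ε, 1)`. [folklore] -/
theorem semistableRealClassAllowance_of_pasten {κ : ℝ} (hκ : 0 ≤ κ) (hP : PastenShapeCubic κ)
    (hB : BaseChangeBookkeeping) (hdoor : SignDoorTotallyReal) :
    SemistableRealClassAllowance κ (κ / 3) := by
  obtain ⟨C, hC⟩ := hP
  refine ⟨(max C 0) ^ ((1 : ℝ) / 3), fun W _ K _ _ hirr hdeg hθ hpos hss => ?_⟩
  haveI : NumberField.IsTotallyReal K := (hdoor K hdeg).mp hpos
  obtain ⟨hssK, hΔeq, hNle⟩ := hB W K hdeg hss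
  have hb := hC K hdeg (W.map (algebraMap ℚ K)) hssK
  rw [hΔeq] at hb
  have hd0 : (0 : ℝ) ≤ |(NumberField.discr K : ℝ)| := abs_nonneg _
  have hN0 : (0 : ℝ) ≤ (W.conductorNorm ℤ : ℝ) := Nat.cast_nonneg _
  have hM : (0 : ℝ) ≤ max C 0 := le_max_right _ _
  have hNK : ((W.map (algebraMap ℚ K)).conductorNorm (𝓞 K) : ℝ) ≤ (W.conductorNorm ℤ : ℝ) ^ 3 := by
    exact_mod_cast hNle
  have key : ((W.minimalDiscriminantNorm ℤ : ℝ)) ^ 3 ≤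
      max C 0 * (|(NumberField.discr K : ℝ)| * (W.conductorNorm ℤ : ℝ) ^ 3) ^ κ := by
    have hb' : ((W.minimalDiscriminantNorm ℤ ^ 3 : ℕ) : ℝ) ≤
        C * (|(NumberField.discr K : ℝ)| * ((W.map (algebraMap ℚ K)).conductorNorm (𝓞 K) : ℝ)) ^ κ := hb
    push_cast at hb'
    calc ((W.minimalDiscriminantNorm ℤ : ℝ)) ^ 3
        ≤ C * (|(NumberField.discr K : ℝ)| * ((W.map (algebraMap ℚ K)).conductorNorm (𝓞 K) : ℝ)) ^ κ := hb'
      _ ≤ max C 0 * (|(NumberField.discr K : ℝ)| * ((W.map (algebraMap ℚ K)).conductorNorm (𝓞 K) : ℝ)) ^ κ :=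
          mul_le_mul_of_nonneg_right (le_max_left _ _) (Real.rpow_nonneg (by positivity) _)
      _ ≤ max C 0 * (|(NumberField.discr K : ℝ)| * (W.conductorNorm ℤ : ℝ) ^ 3) ^ κ :=
          mul_le_mul_of_nonneg_left
            (Real.rpow_le_rpow (by positivity) (mul_le_mul_of_nonneg_left hNK hd0) hκ) hM
  exact cubeRoot_le (Nat.cast_nonneg _) hd0 hN0 hM key

/-! ## §II  Currency surgery against the deciding theorem `closes` -/

/-- **II1.** Class polynomial Szpiro on the real `r = 0` class, `log Δ_min ≤ Λ log N + C` — the weakest statement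
about this class that the landed payoff can consume. -/
def ClassPolySzpiroReal : Prop :=
  ∃ Λ C : ℝ, ∀ (W : WeierstrassCurve ℚ) [W.IsElliptic] (K : Type) [Field K] [NumberField K],
    Irreducible W.twoTorsionPolynomial.toPoly → Module.finrank ℚ K = 3 →
    (∃ θ : K, aeval θ W.twoTorsionPolynomial.toPoly = 0) → 0 < NumberField.discr K →
    Real.log (W.minimalDiscriminantNorm ℤ : ℝ) ≤ Λ * Real.log (W.conductorNorm ℤ : ℝ) + C

/-- The same on the whole `r = 0` class (both signs) — the candidate LOOSENED X1 for the tenure planner. -/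
def ClassPolySzpiroCubic : Prop :=
  ∃ Λ C : ℝ, ∀ (W : WeierstrassCurve ℚ) [W.IsElliptic] (K : Type) [Field K] [NumberField K],
    Irreducible W.twoTorsionPolynomial.toPoly → Module.finrank ℚ K = 3 →
    (∃ θ : K, aeval θ W.twoTorsionPolynomial.toPoly = 0) →
    Real.log (W.minimalDiscriminantNorm ℤ : ℝ) ≤ Λ * Real.log (W.conductorNorm ℤ : ℝ) + C

/-- **II2 (S, PROVED).** The stub, used at `ε = 1` only, together with the landed cubic discriminant bound
`|d_K| ≤ 1944·N²` (item 22743, the first conjunct of `ResolventDiscBounds`), gives `ClassPolySzpiroReal` with slope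
`9` — exactly what `resolventPayoff_proof` extracts from X1 on this class, nothing more. [folklore] -/
theorem classPolySzpiroReal_of_stub (hd : ResolventDiscBounds) (h : StubRealCubic) : ClassPolySzpiroReal := by
  obtain ⟨C, hC⟩ := h 1 one_pos
  refine ⟨9, Real.log (1944 * max C 1), fun W _ K _ _ hirr hdeg hθ hpos => ?_⟩
  have hΔ : (1 : ℝ) ≤ (W.minimalDiscriminantNorm ℤ : ℝ) :=
    Nat.one_le_cast.mpr W.minimalDiscriminantNorm_pos_holds
  have hN : (1 : ℝ) ≤ (W.conductorNorm ℤ : ℝ) := Nat.one_le_cast.mpr W.conductorNorm_pos_holds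
  have hb := hC W K hirr hdeg hθ hpos
  have hdisc := hd.1 W K hirr hdeg hθ
  have := log_le_of_index_bound hΔ hN (abs_nonneg _) (by norm_num) hb hdisc
  exact le_of_slope_const_le (Real.log_nonneg hN) this (by norm_num) le_rfl

/-- **II3 (S, PROVED — the re-glued payoff).** Replacing X1 = `IndexSzpiro` by `ClassPolySzpiroCubic` in the landed
payoff loses nothing: class poly-Szpiro on `r = 0` + X2 + X3 + the resolvent discriminant bounds still give A-PS
for every `E/ℚ` (same trichotomy as `resolventPayoff_proof`).  So the `6 + ε` and the `|d_K|¹` of X1 — and of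
the stub — are over-specification relative to `closes`. [folklore] -/
theorem payoff_of_classPoly (h₁ : ClassPolySzpiroCubic) (h₂ : QuadraticIndexSzpiro) (h₃ : SplitClassPolySzpiro)
    (hd : ResolventDiscBounds) :
    ∃ K C : ℝ, ∀ (W : WeierstrassCurve ℚ) [W.IsElliptic],
      Real.log (W.minimalDiscriminantNorm ℤ : ℝ) ≤ K * Real.log (W.conductorNorm ℤ : ℝ) + C := by
  obtain ⟨Λ₁, C₁, hC₁⟩ := h₁
  obtain ⟨C₂, hC₂⟩ := h₂ 1 one_pos
  obtain ⟨Ks, Cs, hs⟩ := h₃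
  obtain ⟨-, hd₂⟩ := hd
  refine ⟨max (max Λ₁ 8) Ks, max (max C₁ (Real.log (8 * max C₂ 1))) Cs, ?_⟩
  intro W _
  have hΔ : (1 : ℝ) ≤ (W.minimalDiscriminantNorm ℤ : ℝ) :=
    Nat.one_le_cast.mpr W.minimalDiscriminantNorm_pos_holds
  have hN : (1 : ℝ) ≤ (W.conductorNorm ℤ : ℝ) := Nat.one_le_cast.mpr W.conductorNorm_pos_holds
  have hlogN : 0 ≤ Real.log (W.conductorNorm ℤ : ℝ) := Real.log_nonneg hN
  have hdeg : W.twoTorsionPolynomial.toPoly.natDegree = 3 :=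
    Cubic.natDegree_of_a_ne_zero (by norm_num [WeierstrassCurve.twoTorsionPolynomial])
  rcases cubic_trichotomy hdeg with ⟨e₁, e₂, e₃, hroots⟩ | hirr | ⟨g, hg, hg2, hgf⟩
  · exact le_of_slope_const_le hlogN (hs W ⟨e₁, e₂, e₃, hroots⟩) (le_max_right _ _) (le_max_right _ _)
  · obtain ⟨K, _, _, hfin, θ, hθ, -⟩ := exists_numberField_root hirr (by omega) (by omega) dvd_rfl
    rw [hdeg] at hfin
    have hb := hC₁ W K hirr hfin ⟨θ, hθ⟩
    exact le_of_slope_const_le hlogN hb (le_trans (le_max_left _ _) (le_max_left _ _))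
      (le_trans (le_max_left _ _) (le_max_left _ _))
  · obtain ⟨K, _, _, hfin, θ, hθ, hirrat⟩ := exists_numberField_root hg (by omega) (by omega) hgf
    rw [hg2] at hfin
    have hb := hC₂ W K hfin ⟨θ, hθ, hirrat⟩
    have hdisc := hd₂ W K hfin ⟨θ, hθ, hirrat⟩
    rw [← pow_one (W.conductorNorm ℤ : ℝ)] at hdisc
    have := log_le_of_index_bound hΔ hN (abs_nonneg _) (by norm_num) hb hdisc
    refine le_of_slope_const_le hlogN this ?_ (le_trans (le_max_right _ _) (le_max_left _ _))
    exact le_trans (by norm_num) (le_trans (le_max_right _ _) (le_max_left _ _))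

/-- **II4 (S, PROVED — certificate that II3 is a drop-in for X1 in `closes`).** With `ClassPolySzpiroCubic` in place of
`IndexSzpiro` the route's deciding chain still ends in the summit statement, through the route's own residual item
`ResolventResidual` (A-PS → abc, open, declared residual).  An implication between typed statements; nothing is
claimed about `ABC`. [folklore] -/
theorem reglued_closes_shape (h₁ : ClassPolySzpiroCubic) (h₂ : QuadraticIndexSzpiro) (h₃ : SplitClassPolySzpiro)
    (hd : ResolventDiscBounds) (hres : ResolventResidual) : _root_.ABC :=
  hres (payoff_of_classPoly h₁ h₂ h₃ hd)

/-! ## §III  The two-parameter allowance ladder `S(Λ, A)` on the real class -/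

/-- **III1.** `S(Λ, A)`: `Δ_min ≤ C · |d_K|^A · N^Λ` on the real `r = 0` class. -/
def StubRealAllowance (Λ A : ℝ) : Prop :=
  ∃ C : ℝ, ∀ (W : WeierstrassCurve ℚ) [W.IsElliptic] (K : Type) [Field K] [NumberField K],
    Irreducible W.twoTorsionPolynomial.toPoly → Module.finrank ℚ K = 3 →
    (∃ θ : K, aeval θ W.twoTorsionPolynomial.toPoly = 0) → 0 < NumberField.discr K →
    (W.minimalDiscriminantNorm ℤ : ℝ) ≤ C * |(NumberField.discr K : ℝ)| ^ A * (W.conductorNorm ℤ : ℝ) ^ Λ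

/-- **III2 (S, PROVED).** The stub is the `A = 1` column of the ladder: `stub ⟺ ∀ ε > 0, S(6 + ε, 1)`. [folklore] -/
theorem stubRealCubic_iff_allowance : StubRealCubic ↔ ∀ ε : ℝ, 0 < ε → StubRealAllowance (6 + ε) 1 := by
  simp only [StubRealCubic, StubRealAllowance, Real.rpow_one]

/-- **III3 (S, PROVED).** The ladder is monotone in both parameters (`|d_K| ≥ 1`, `N ≥ 1`). [folklore] -/
theorem StubRealAllowance.mono {Λ Λ' A A' : ℝ} (hΛ : Λ ≤ Λ') (hA : A ≤ A') (h : StubRealAllowance Λ A) :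
    StubRealAllowance Λ' A' := by
  obtain ⟨C, hC⟩ := h
  refine ⟨max C 0, fun W _ K _ _ hirr hdeg hθ hpos => ?_⟩
  have hd1 : (1 : ℝ) ≤ |(NumberField.discr K : ℝ)| := by
    rw [← Int.cast_abs]; exact_mod_cast Int.one_le_abs (NumberField.discr_ne_zero K)
  have hN : (1 : ℝ) ≤ (W.conductorNorm ℤ : ℝ) := Nat.one_le_cast.mpr W.conductorNorm_pos_holds
  have hM : (0 : ℝ) ≤ max C 0 := le_max_right _ _
  have h1 : |(NumberField.discr K : ℝ)| ^ A ≤ |(NumberField.discr K : ℝ)| ^ A' :=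
    Real.rpow_le_rpow_of_exponent_le hd1 hA
  have h2 : (W.conductorNorm ℤ : ℝ) ^ Λ ≤ (W.conductorNorm ℤ : ℝ) ^ Λ' :=
    Real.rpow_le_rpow_of_exponent_le hN hΛ
  calc (W.minimalDiscriminantNorm ℤ : ℝ)
      ≤ C * |(NumberField.discr K : ℝ)| ^ A * (W.conductorNorm ℤ : ℝ) ^ Λ := hC W K hirr hdeg hθ hpos
    _ ≤ max C 0 * |(NumberField.discr K : ℝ)| ^ A * (W.conductorNorm ℤ : ℝ) ^ Λ :=
        mul_le_mul_of_nonneg_right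
          (mul_le_mul_of_nonneg_right (le_max_left _ _) (Real.rpow_nonneg (abs_nonneg _) _))
          (Real.rpow_nonneg (Nat.cast_nonneg _) _)
    _ ≤ max C 0 * |(NumberField.discr K : ℝ)| ^ A' * (W.conductorNorm ℤ : ℝ) ^ Λ' :=
        mul_le_mul (mul_le_mul_of_nonneg_left h1 hM) h2 (Real.rpow_nonneg (Nat.cast_nonneg _) _)
          (mul_nonneg hM (Real.rpow_nonneg (abs_nonneg _) _))

/-- **III4 (S, PROVED).** The `ε = 1` rung actually consumed downstream: `stub → S(7, 1)`. [folklore] -/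
theorem allowance_seven_one_of_stub (h : StubRealCubic) : StubRealAllowance 7 1 := by
  have h' := (stubRealCubic_iff_allowance.mp h) 1 one_pos
  norm_num at h'
  exact h'

end Summit.ABC.ABC.Cruxes.IndexSzpiro.StubIdeas2RealG8

end
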